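import Literature.AnabelianGeometry.SemiGraphs.ArithIntersectionOfAction
import Literature.AnabelianGeometry.SemiGraphs.ArithLevelDataThm54
import Literature.AnabelianGeometry.SemiGraphs.ArithVerticialCompactAmple
import HarnessLib

/-!
# [SemiAnbd] Thm 5.4 (i) ∧ (ii) for the PRODUCED decomposition data of p. 65 (umbrella, proof-only)

Mochizuki, *Semi-graphs of Anabelioids*, Publ. RIMS **42** (2006) 221–322, §5, Theorem 5.4 (i)(ii)
p. 66, for the decomposition data `Π^temp_{𝔊,v}`, `Π^temp_{𝔊,b}` of p. 65 ("which may be thought of as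
the commensurator[s] … of `Π^temp_{𝔾,v}`, `Π^temp_{𝔾,b}`"). [cite: MochizukiSemiAnbd2006, Thm 5.4 (i)(ii), p. 66]

PROOF-ONLY umbrella (abc-iut cell, L3 sub-DAG #4 `plan/L3/SUBDAG-SemiAnbd-Thm54.md`; GO of the T54-0
producer abc-iut-w4-d053 2026-08-26T01:05:27Z; seat abc-iut-w4-d040): the rows of the sub-DAG COMPOSE
in the kernel for the PRODUCED data `decompositionDataOfChart R ι` (abc-iut-w4-d053,
`ArithDecompositionData.lean`):
* (i) and (ii) packaged over the arithmetic level data — `ArithLevelData.arithMaximalCompactStatementI_of`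
  / `…II_of` (abc-iut-w4-d053 `ArithLevelDataThm54.lean`, fed by abc-iut-w4-d059's level-data proof
  of (i) and hEV, abc-iut-w4-d029's clause 1 and (∗_j), abc-iut-w4-d085's reduction of (ii));
* `habuts` = `abut_isSome_of_isGraph` (graphs of anabelioids: every branch abuts);
* Rmk 5.3.1 first sentence `hR` at LEVEL A — abc-iut-w4-d029's
  `verticialEdgeLikeCompactAmple_decompositionDataOfChart` (its inputs `hconjV`, `hU` read off the
  chart-action package, `hιaug` from exactness);
* `hVE` at LEVEL A — `not_isEdgeLike_of_isVerticial_ofChart_of_action` (`ArithIntersectionOfAction.lean`).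

RESIDUAL BINDERS (honest list): the producer debt of row T54-B — the hypothesis packages
`L : ArithLevelData …` (trees/actions/dictionary) and `A : ArithChartAction …` (Def 5.1 (i) on the
chart), the pair-conjugation property `hconjPair` and the LEVEL-B compactness `hVc`, `hBc` of the
decomposition groups —, the named §3 fact `CompactInVerticial` (Thm 3.7 (iii)), and the print
hypotheses: `Thm37Hypotheses`/`IsGraph` on `𝒢`, total arithmetic estrangement `hest` (Def 5.3 (ii)),
`hbot` "`Π_A` is not discrete" (dischargeable by abc-iut-w4-d098's `not_isArithAmple_bot_of_compactSpace`),
Prop 5.2 (iv) exactness `hexact` and surjectivity `hsurj`.  CONDITIONAL on these; typed ≠ proved beyond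
them; nothing here takes a side on [IUTchIII] Cor. 3.12.

Universe note: `ArithLevelDataThm54.lean` states the package over `Gtp` and the semi-graph in ONE
universe, so here `Gtp : Type u` with `𝒢 : ProfiniteSemiGraph.{u}`.
-/

namespace Literature.AnabelianGeometry.SemiGraphs

namespace ProfiniteSemiGraph

open CategoryTheory Topology
open scoped Pointwise

universe u u''

variable {𝒢 : ProfiniteSemiGraph.{u}} {c : TemperedPiChart 𝒢}
  {Gtp : Type u} [Group Gtp] [TopologicalSpace Gtp] [IsTopologicalGroup Gtp]
  {PA : Type u''} [Group PA] [TopologicalSpace PA] [IsTopologicalGroup PA]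

/-- **[SemiAnbd] Thm 5.4 (i) ∧ (ii) for the PRODUCED decomposition data** `decompositionDataOfChart R ι`
of p. 65 ("Every arithmetically ample compact subgroup of `π₁^temp(𝔊)` is contained in at least one
verticial subgroup … precisely two …, whose intersection forms an edge-like subgroup"; "The
arithmetically maximal compact subgroups … are precisely the verticial subgroups; the arithmetically
ample intersections of two distinct [ones] are precisely the edge-like subgroups"), assembled from the
rows of the sub-DAG: (i)/(ii) over the level data (`ArithLevelData.arithMaximalCompactStatementI_of`,
`…II_of`), `hR` at LEVEL A (`verticialEdgeLikeCompactAmple_decompositionDataOfChart`) and `hVE` at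
LEVEL A (`not_isEdgeLike_of_isVerticial_ofChart_of_action`).  CONDITIONAL on the packages `L`, `A`,
on `hconjPair`, `hVc`, `hBc`, on `CompactInVerticial`, and on the print hypotheses.
[cite: MochizukiSemiAnbd2006, Thm 5.4 (i)(ii), p. 66] -/
theorem arithMaximalCompactStatementI_and_II_ofChart [T2Space Gtp] (hCV : CompactInVerticial.{u})
    (h𝒢 : 𝒢.Thm37Hypotheses) (hG : 𝒢.graph.IsGraph) (R : ChartRepresentatives c) (ι : c.G →* Gtp)
    (hι : Function.Injective ι) (aug : Gtp →* PA) (hexact : ι.range = aug.ker)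
    (hsurj : Function.Surjective aug) {baseAct : PA →* Aut 𝒢.graph}
    (L : ArithLevelData 𝒢.graph (decompositionDataOfChart R ι) aug baseAct)
    {actV : PA → 𝒢.graph.Vertex → 𝒢.graph.Vertex} {actE : PA → 𝒢.graph.Edge → 𝒢.graph.Edge}
    {actB : PA → 𝒢.graph.Branch → 𝒢.graph.Branch} (A : ArithChartAction c ι aug actV actE actB)
    (hest : IsTotallyArithEstranged (decompositionDataOfChart R ι) aug) (hbot : ¬ IsArithAmple aug ⊥)
    (hconjPair : ∀ (b : 𝒢.graph.Branch) (v : 𝒢.graph.Vertex), 𝒢.graph.abuts b = some v →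
      ∃ U : Subgroup PA, IsOpen (U : Set PA) ∧ ∀ a ∈ U, ∃ g : Gtp, aug g = a ∧ ∃ h : c.G,
        conjSubgroup g ((R.Hv v).map ι) = conjSubgroup (ι h) ((R.Hv v).map ι) ∧
          conjSubgroup g ((R.Hb b).map ι) = conjSubgroup (ι h) ((R.Hb b).map ι))
    (hVc : ∀ v, IsCompact (arithVertGp R ι v : Set Gtp))
    (hBc : ∀ b, IsCompact (arithBrGp R ι b : Set Gtp)) :
    ArithMaximalCompactStatementI (decompositionDataOfChart R ι) aug ∧
      ArithMaximalCompactStatementII (decompositionDataOfChart R ι) aug := by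
  have habuts := abut_isSome_of_isGraph R ι hG
  have hιaug : ∀ h : c.G, aug (ι h) = 1 := fun h => by
    rw [← MonoidHom.mem_ker, ← hexact]; exact ⟨h, rfl⟩
  obtain ⟨U, hUo, hU⟩ := A.exists_open_trivial
  -- Rmk 5.3.1, first sentence, at LEVEL A (row T54-1)
  have hR : VerticialEdgeLikeCompactAmpleStatement (decompositionDataOfChart R ι) aug :=
    verticialEdgeLikeCompactAmple_decompositionDataOfChart R ι aug actV hιaug hsurj A.conj_verticial
      ⟨U, hUo, fun a ha => (hU a ha).1⟩ (fun b => Option.isSome_iff_exists.mp (hG.abuts_isSome b))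
      hconjPair hVc hBc
  exact ⟨L.arithMaximalCompactStatementI_of habuts hest hbot,
    L.arithMaximalCompactStatementII_of habuts hest hbot hR
      fun _ hK => not_isEdgeLike_of_isVerticial_ofChart_of_action hCV h𝒢 hG R ι hι aug hexact A hK⟩

/-- **Thm 5.4 (ii) alone for the produced data**, same inputs (the conjunct most consumers want:
"arithmetically maximal compact = verticial; ample intersections of two distinct ones = edge-like").
[cite: MochizukiSemiAnbd2006, Thm 5.4 (ii), p. 66] -/
theorem arithMaximalCompactStatementII_ofChart_of_levelData [T2Space Gtp] (hCV : CompactInVerticial.{u})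
    (h𝒢 : 𝒢.Thm37Hypotheses) (hG : 𝒢.graph.IsGraph) (R : ChartRepresentatives c) (ι : c.G →* Gtp)
    (hι : Function.Injective ι) (aug : Gtp →* PA) (hexact : ι.range = aug.ker)
    (hsurj : Function.Surjective aug) {baseAct : PA →* Aut 𝒢.graph}
    (L : ArithLevelData 𝒢.graph (decompositionDataOfChart R ι) aug baseAct)
    {actV : PA → 𝒢.graph.Vertex → 𝒢.graph.Vertex} {actE : PA → 𝒢.graph.Edge → 𝒢.graph.Edge}
    {actB : PA → 𝒢.graph.Branch → 𝒢.graph.Branch} (A : ArithChartAction c ι aug actV actE actB)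
    (hest : IsTotallyArithEstranged (decompositionDataOfChart R ι) aug) (hbot : ¬ IsArithAmple aug ⊥)
    (hconjPair : ∀ (b : 𝒢.graph.Branch) (v : 𝒢.graph.Vertex), 𝒢.graph.abuts b = some v →
      ∃ U : Subgroup PA, IsOpen (U : Set PA) ∧ ∀ a ∈ U, ∃ g : Gtp, aug g = a ∧ ∃ h : c.G,
        conjSubgroup g ((R.Hv v).map ι) = conjSubgroup (ι h) ((R.Hv v).map ι) ∧
          conjSubgroup g ((R.Hb b).map ι) = conjSubgroup (ι h) ((R.Hb b).map ι))
    (hVc : ∀ v, IsCompact (arithVertGp R ι v : Set Gtp))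
    (hBc : ∀ b, IsCompact (arithBrGp R ι b : Set Gtp)) :
    ArithMaximalCompactStatementII (decompositionDataOfChart R ι) aug :=
  (arithMaximalCompactStatementI_and_II_ofChart hCV h𝒢 hG R ι hι aug hexact hsurj L A hest hbot
    hconjPair hVc hBc).2

end ProfiniteSemiGraph

end Literature.AnabelianGeometry.SemiGraphs
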